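import Summits.BirchSwinnertonDyer.BirchSwinnertonDyer.Theorems.GoldfeldAllTwistsTwoConverseTwinBirchLocal
import HarnessLib

set_option linter.dupNamespace false -- `…BirchSwinnertonDyer.BirchSwinnertonDyer…` is the cell's namespace (D-0017)
set_option autoImplicit false

/-!
# LINE B49 — THEOREM B, local input (B1b): `c₂ = 4` for the two `ℚ₂`-classes of the inert prime twists —
# `c₂(49a1^{(−1)}) = 4` (file X, transported to `X₀(49)^{(−4)}`) and the NEW certificate `c₂(49a1^{(−5)}) = 4`

Cell `bsd-goldfeld`, seat `bsd-goldfeld-s1p-c301` (prover, gen 8); planner ruling g19 (liii), scope memo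
`HOME/GENUS-THEOREM-B.md` factor F9 (`c₂ = 4` on the whole family: `q ≡ 1 (8)` ⇒ `V_q ≅ X₀(49)^{(−4)}` over `ℚ₂`,
`q ≡ 5 (8)` ⇒ `V_q ≅ X₀(49)^{(−20)}` over `ℚ₂`). Support for item `stmt-BirchSwinnertonDyer-19140` (twin″); Theses-free;
theorems only. HONEST FRAMING: local arithmetic at `2` of two explicit curves; nothing about `L`-values or BSD.

WHAT IS PROVED.
* §1 `c₂(X₀(49)^{(−4)}) = 4` (`localTamagawaNumber_padic_cm7_quadraticTwist_neg_four`): `X₀(49)^{(−4)} ≅ W₇₈₄ =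
  [0, −21, 0, 112, 0]` over `ℚ` (`quadraticTwist_cm7_four_mul`, `twoTorsionChange_smul_cm7_quadraticTwist_neg_one_rat`),
  and file X's `localTamagawaNumber_padic_W784_two`.
* §2 **`c₂(E₋₅) = 4`** for `E₋₅ = [0, −105, 0, 2800, 0]` (the two-torsion model of `49a1^{(−5)}`,
  `twoTorsionChange • X₀(49)^{(−5)}`), by the argument of file X: the translate `J₅ = (1, 0, −1, 0) • E₋₅ =
  [−2, −106, 0, 2800, 0]` is an `Iₙ*` normal form over `ℤ₂` (`a₁ ∈ 𝔪`, `a₂ = −106 ∈ 𝔪 ∖ 𝔪²`, `a₃ ∈ 𝔪²`,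
  `a₄ = 2⁴·175 ∈ 𝔪³`, `a₆ = 0`), minimal at `2` (Kraus: `2⁸ ∤ c₄ = 2⁴·2625`, `c₆/64 + 1 = −165374 ≢ 0 (mod 4)`), and
  its three `ℚ₂`-points `T = (0,0)`, `g = (50, 100)` (from the RATIONAL point `(50, 50)` of `E₋₅`:
  `50³ − 105·50² + 2800·50 = 2500 = 50²`) and `g + T = (56, 0)` reduce to the singular point, so the index
  `[J₅(ℚ₂) : J₅,₀(ℚ₂)] ∈ {2, 4}` (`LocalIndex.index_mem_of_normalForm_Istar_succ`) is `4`.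
* §3 `c₂(X₀(49)^{(−20)}) = 4` (`X₀(49)^{(−20)} = ⟨½,0,0,0⟩ • X₀(49)^{(−5)} ≅ E₋₅` over `ℚ`).
References: [Silverman1994] IV.9.4 Step 7 and Table 4.1; [SilvermanAEC2009] VII.1.3(b), VII.6; [Kraus1989] Prop. 2;
[CremonaAlgorithms1997] Table 1 (N = 784: `c₂ = 4`; N = 19600 = 784·25, curve `49a1^{(−5)}`: `c₂ = 4`); kit j269009.
-/

noncomputable section

open scoped Classical NumberField

open WeierstrassCurve IsDedekindDomain IsLocalRing Rat.HeightOneSpectrum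
  Literature.NumberTheory.EllipticCurves Literature.NumberTheory.EllipticCurves.ModularForms
  Summit.BirchSwinnertonDyer.BirchSwinnertonDyer.Rank2Observatory.Tate
  Summit.BirchSwinnertonDyer.BirchSwinnertonDyer.Rank2Observatory.RootNumber

namespace Summit.BirchSwinnertonDyer.BirchSwinnertonDyer.Theorems.GoldfeldGoodTwists

/-! ## §1 `c₂(X₀(49)^{(−4)}) = 4` from file X -/

/-- `W₇₈₄ = [0, −21, 0, 112, 0] = C • X₀(49)^{(−4)}` with `C = twoTorsionChange · ⟨½,0,0,0⟩⁻¹` over `ℚ`.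
[cite: SilvermanAEC2009, X.5 Cor. 5.4] -/
theorem smul_cm7_quadraticTwist_neg_four_eq_W784 :
    ((⟨(Units.mk0 (2 : ℚ) two_ne_zero)⁻¹, -2, 0, 0⟩ : VariableChange ℚ) *
        (⟨(Units.mk0 (2 : ℚ) two_ne_zero)⁻¹, 0, 0, 0⟩ : VariableChange ℚ)⁻¹) • cm7.quadraticTwist (-4) =
      (⟨0, -21, 0, 112, 0⟩ : WeierstrassCurve ℚ) := by
  have h := quadraticTwist_cm7_four_mul (-1)
  rw [show ((4 * (-1 : ℤ) : ℤ) : ℚ) = -4 by norm_num, show ((-1 : ℤ) : ℚ) = -1 by norm_num] at h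
  rw [mul_smul, h, inv_smul_smul]
  exact twoTorsionChange_smul_cm7_quadraticTwist_neg_one_rat

/-- **`c₂(X₀(49)^{(−4)}) = 4`** (Mathlib's `2`-adics): `X₀(49)^{(−4)} ≅ W₇₈₄` over `ℚ`, hence over `ℚ₂`, and
`c₂(W₇₈₄) = 4` (file X). [cite: Silverman1994, IV.9.4 Step 7 and Table 4.1] [cite: CremonaAlgorithms1997, Table 1 (N = 784)] -/
theorem localTamagawaNumber_padic_cm7_quadraticTwist_neg_four :
    (haveI := cm7.isElliptic_quadraticTwist (show (-4 : ℚ) ≠ 0 by norm_num)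
     ((cm7.quadraticTwist (-4)).baseChange ℚ_[2]).localTamagawaNumber ℤ_[2]) = 4 := by
  haveI := cm7.isElliptic_quadraticTwist (show (-4 : ℚ) ≠ 0 by norm_num)
  haveI := isElliptic_twoTorsionModel_neg_one
  set C := ((⟨(Units.mk0 (2 : ℚ) two_ne_zero)⁻¹, -2, 0, 0⟩ : VariableChange ℚ) *
    (⟨(Units.mk0 (2 : ℚ) two_ne_zero)⁻¹, 0, 0, 0⟩ : VariableChange ℚ)⁻¹) with hC
  have e : (⟨0, -21, 0, 112, 0⟩ : WeierstrassCurve ℚ).baseChange ℚ_[2] =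
      (C.map (algebraMap ℚ ℚ_[2])) • (cm7.quadraticTwist (-4)).baseChange ℚ_[2] := by
    rw [← VariableChange.baseChange_smul_eq, smul_cm7_quadraticTwist_neg_four_eq_W784]
  have h := localTamagawaNumber_padic_W784_two
  rw [e, WeierstrassCurve.localTamagawaNumber_variableChange_holds ℤ_[2] ((cm7.quadraticTwist (-4)).baseChange ℚ_[2])] at h
  exact h

/-! ## §2 The certificate `c₂(E₋₅) = 4`, `E₋₅ = [0, −105, 0, 2800, 0] = two-torsion model of 49a1^{(−5)}` -/

/-- The two-torsion change for `d = −5`: `(1/2, −10, 0, 0) • X₀(49)^{(−5)} = [0, −105, 0, 2800, 0]`.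
[cite: SilvermanAEC2009, III.1 Table 3.1] -/
theorem twoTorsionChange_smul_cm7_quadraticTwist_neg_five :
    (⟨(Units.mk0 (2 : ℚ) two_ne_zero)⁻¹, -10, 0, 0⟩ : VariableChange ℚ) • cm7.quadraticTwist (-5) =
      ⟨0, -105, 0, 2800, 0⟩ := by
  ext <;> simp [quadraticTwist, b₂, b₄, b₆, variableChange_a₁, variableChange_a₂,
    variableChange_a₃, variableChange_a₄, variableChange_a₆] <;> norm_num

/-- `E₋₅ = [0, −105, 0, 2800, 0]` is elliptic. [folklore] -/
theorem isElliptic_twoTorsionModel_neg_five : (⟨0, -105, 0, 2800, 0⟩ : WeierstrassCurve ℚ).IsElliptic := by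
  haveI := cm7.isElliptic_quadraticTwist (show (-5 : ℚ) ≠ 0 by norm_num)
  rw [← twoTorsionChange_smul_cm7_quadraticTwist_neg_five]; infer_instance

/-- `[0, −105, 0, 2800, 0] = ℤ-model ⊗ ℚ`. [folklore] -/
theorem twoTorsionModel_neg_five_eq_baseChange :
    (⟨0, -105, 0, 2800, 0⟩ : WeierstrassCurve ℚ) = (⟨0, -105, 0, 2800, 0⟩ : WeierstrassCurve ℤ).baseChange ℚ := by
  ext <;> simp [baseChange]

/-- Invariants of `[0, −105, 0, 2800, 0]`: `c₄ = 42000 = 2⁴·2625`, `c₆ = 64·(−165375)`. [folklore] -/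
theorem invariants_twoTorsionModel_neg_five :
    (⟨0, -105, 0, 2800, 0⟩ : WeierstrassCurve ℤ).c₄ = 42000 ∧
      (⟨0, -105, 0, 2800, 0⟩ : WeierstrassCurve ℤ).c₆ = 64 * (-165375) := by
  refine ⟨by decide, by decide⟩

/-- **`[0, −105, 0, 2800, 0]` is minimal at `2`** (Kraus: `2⁸ ∤ c₄ = 2⁴·2625`, `c₆/64 + 1 = −165374 ≢ 0 (mod 4)`).
[cite: Kraus1989, Prop. 2] -/
theorem isMinimalAt_twoTorsionModel_neg_five_two (v : HeightOneSpectrum (𝓞 ℚ)) (hv : natGenerator v = 2) :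
    ((⟨0, -105, 0, 2800, 0⟩ : WeierstrassCurve ℤ).baseChange ℚ).IsMinimalAt v := by
  obtain ⟨h4, h6⟩ := invariants_twoTorsionModel_neg_five
  exact isMinimalAt_two_of_kraus_fails_int v hv _ (by rw [h4]; decide) h6 (by decide)

/-- The `2`-adically normalised model `J₅ = (1, 0, −1, 0) • [0, −105, 0, 2800, 0] = [−2, −106, 0, 2800, 0]`.
[cite: Silverman1994, IV.9.4 Step 7] -/
theorem model_E5_two :
    (⟨-2, -106, 0, 2800, 0⟩ : WeierstrassCurve ℤ) = (⟨1, 0, -1, 0⟩ : VariableChange ℤ) • ⟨0, -105, 0, 2800, 0⟩ := by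
  ext <;> simp [variableChange_a₁, variableChange_a₂, variableChange_a₃, variableChange_a₄, variableChange_a₆]

/-- `T = (0, 0) ∈ J₅(ℚ₂)`. [folklore] -/
theorem nonsingular_J5_zero_zero :
    ((⟨-2, -106, 0, 2800, 0⟩ : WeierstrassCurve ℤ_[2]).baseChange ℚ_[2]).toAffine.Nonsingular
      (algebraMap ℤ_[2] ℚ_[2] 0) (algebraMap ℤ_[2] ℚ_[2] 0) := by
  rw [Affine.nonsingular_iff', Affine.equation_iff']
  simp only [baseChange, toAffine, map_a₁, map_a₂, map_a₃, map_a₄, map_a₆, map_neg, map_ofNat, map_zero]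
  norm_num

/-- `g = (50, 100) ∈ J₅(ℚ₂)` (the image of the rational point `(50, 50) ∈ E₋₅(ℚ)` under `(x, y) ↦ (x, y + x)`).
[folklore] -/
theorem nonsingular_J5_fifty :
    ((⟨-2, -106, 0, 2800, 0⟩ : WeierstrassCurve ℤ_[2]).baseChange ℚ_[2]).toAffine.Nonsingular
      (algebraMap ℤ_[2] ℚ_[2] 50) (algebraMap ℤ_[2] ℚ_[2] 100) := by
  rw [Affine.nonsingular_iff', Affine.equation_iff']
  simp only [baseChange, toAffine, map_a₁, map_a₂, map_a₃, map_a₄, map_a₆, map_neg, map_ofNat, map_zero]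
  norm_num

/-- `g + T = (56, 0) ∈ J₅(ℚ₂)`. [folklore] -/
theorem nonsingular_J5_fiftysix_zero :
    ((⟨-2, -106, 0, 2800, 0⟩ : WeierstrassCurve ℤ_[2]).baseChange ℚ_[2]).toAffine.Nonsingular
      (algebraMap ℤ_[2] ℚ_[2] 56) (algebraMap ℤ_[2] ℚ_[2] 0) := by
  rw [Affine.nonsingular_iff', Affine.equation_iff']
  simp only [baseChange, toAffine, map_a₁, map_a₂, map_a₃, map_a₄, map_a₆, map_neg, map_ofNat, map_zero]
  norm_num

/-- **`g + T = (56, 0)` in `J₅(ℚ₂)`** (slope `2`). [folklore] -/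
theorem fifty_add_zeroZero_J5 :
    (Affine.Point.some _ _ nonsingular_J5_fifty :
        ((⟨-2, -106, 0, 2800, 0⟩ : WeierstrassCurve ℤ_[2]).baseChange ℚ_[2]).toAffine.Point) +
      Affine.Point.some _ _ nonsingular_J5_zero_zero =
      Affine.Point.some _ _ nonsingular_J5_fiftysix_zero := by
  have hx : algebraMap ℤ_[2] ℚ_[2] 50 ≠ algebraMap ℤ_[2] ℚ_[2] 0 := by
    rw [map_ofNat, map_zero]; norm_num
  rw [Affine.Point.add_of_X_ne hx]
  refine point_some_congr ?_ ?_
  · rw [Affine.slope_of_X_ne hx]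
    simp only [Affine.addX, baseChange, toAffine, map_a₁, map_a₂, map_neg, map_ofNat, map_zero]
    norm_num
  · rw [Affine.addY, Affine.negAddY, Affine.negY, Affine.slope_of_X_ne hx]
    simp only [Affine.addX, baseChange, toAffine, map_a₁, map_a₂, map_a₃, map_neg, map_ofNat, map_zero]
    norm_num

/-- **`[J₅(ℚ₂) : J₅,₀(ℚ₂)] = 4`** (`Iₙ*` normal form, index `2` or `4`; the points `T`, `g`, `g + T` reduce to the
singular point). [cite: Silverman1994, IV.9.4 Step 7 and Table 4.1] -/
theorem index_nonsingularReductionSubgroup_J5 :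
    ((⟨-2, -106, 0, 2800, 0⟩ : WeierstrassCurve ℤ_[2]).nonsingularReductionSubgroup
      (integers_valuationRing_valuation ℤ_[2] ℚ_[2])).index = 4 := by
  haveI : HenselianLocalRing ℤ_[2] :=
    { is_henselian := fun f hf a₀ h₁ h₂ =>
        HenselianRing.is_henselian (I := IsLocalRing.maximalIdeal ℤ_[2]) f hf a₀ h₁ (h₂.map _) }
  set H := (⟨-2, -106, 0, 2800, 0⟩ : WeierstrassCurve ℤ_[2]).nonsingularReductionSubgroup
    (integers_valuationRing_valuation ℤ_[2] ℚ_[2]) with hH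
  have hΔ : (⟨-2, -106, 0, 2800, 0⟩ : WeierstrassCurve ℤ_[2]).Δ ≠ 0 := by
    simp only [WeierstrassCurve.Δ, b₂, b₄, b₆, b₈]; norm_num
  have h1 : (⟨-2, -106, 0, 2800, 0⟩ : WeierstrassCurve ℤ_[2]).a₁ ∈ maximalIdeal ℤ_[2] := by
    have h := (intCast_mem_maximalIdeal_pow_padicInt_two_iff (-2) 1).mpr (by norm_num)
    rw [pow_one] at h; simpa using h
  have h2 : (⟨-2, -106, 0, 2800, 0⟩ : WeierstrassCurve ℤ_[2]).a₂ ∈ maximalIdeal ℤ_[2] := by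
    have h := (intCast_mem_maximalIdeal_pow_padicInt_two_iff (-106) 1).mpr (by norm_num)
    rw [pow_one] at h; simpa using h
  have h2' : (⟨-2, -106, 0, 2800, 0⟩ : WeierstrassCurve ℤ_[2]).a₂ ∉ maximalIdeal ℤ_[2] ^ 2 := by
    have h := (intCast_mem_maximalIdeal_pow_padicInt_two_iff (-106) 2).not.mpr (by norm_num)
    simpa using h
  have h3 : (⟨-2, -106, 0, 2800, 0⟩ : WeierstrassCurve ℤ_[2]).a₃ ∈ maximalIdeal ℤ_[2] ^ 2 := by simp
  have h4 : (⟨-2, -106, 0, 2800, 0⟩ : WeierstrassCurve ℤ_[2]).a₄ ∈ maximalIdeal ℤ_[2] ^ 3 := by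
    have h := (intCast_mem_maximalIdeal_pow_padicInt_two_iff 2800 3).mpr (by norm_num)
    simpa using h
  have h6 : (⟨-2, -106, 0, 2800, 0⟩ : WeierstrassCurve ℤ_[2]).a₆ ∈ maximalIdeal ℤ_[2] ^ 4 := by simp
  rcases LocalIndex.index_mem_of_normalForm_Istar_succ (K := ℚ_[2]) _ hΔ h1 h2 h2' h3 h4 h6 with h | h
  swap
  · exact h
  exfalso
  have h3₁ : (⟨-2, -106, 0, 2800, 0⟩ : WeierstrassCurve ℤ_[2]).a₃ ∈ maximalIdeal ℤ_[2] := by simp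
  have h4₁ : (⟨-2, -106, 0, 2800, 0⟩ : WeierstrassCurve ℤ_[2]).a₄ ∈ maximalIdeal ℤ_[2] := by
    simpa using natCast_mem_maximalIdeal_padicInt_two (n := 2800) (by norm_num)
  have h0 : (0 : ℤ_[2]) ∈ maximalIdeal ℤ_[2] := Ideal.zero_mem _
  have h50 : (50 : ℤ_[2]) ∈ maximalIdeal ℤ_[2] := by
    simpa using natCast_mem_maximalIdeal_padicInt_two (n := 50) (by norm_num)
  have h100 : (100 : ℤ_[2]) ∈ maximalIdeal ℤ_[2] := by
    simpa using natCast_mem_maximalIdeal_padicInt_two (n := 100) (by norm_num)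
  have h56 : (56 : ℤ_[2]) ∈ maximalIdeal ℤ_[2] := by
    simpa using natCast_mem_maximalIdeal_padicInt_two (n := 56) (by norm_num)
  have hT : (Affine.Point.some _ _ nonsingular_J5_zero_zero) ∉ H := fun hmem =>
    LocalIndex.not_hasNonsingularReduction_some _ h3₁ h4₁ h0 h0 nonsingular_J5_zero_zero
      ((mem_nonsingularReductionSubgroup_iff _).mp hmem)
  have hg : (Affine.Point.some _ _ nonsingular_J5_fifty) ∉ H := fun hmem =>
    LocalIndex.not_hasNonsingularReduction_some _ h3₁ h4₁ h50 h100 nonsingular_J5_fifty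
      ((mem_nonsingularReductionSubgroup_iff _).mp hmem)
  have hgT : (Affine.Point.some _ _ nonsingular_J5_fiftysix_zero) ∉ H := fun hmem =>
    LocalIndex.not_hasNonsingularReduction_some _ h3₁ h4₁ h56 h0 nonsingular_J5_fiftysix_zero
      ((mem_nonsingularReductionSubgroup_iff _).mp hmem)
  obtain ⟨a, ha⟩ := AddSubgroup.index_eq_two_iff.mp h
  have key : ∀ P, P ∉ H → P + a ∈ H := fun P hP => by
    rcases ha P with ⟨h', -⟩ | ⟨h', -⟩
    · exact h'
    · exact (hP h').elim
  have ha' : a ∈ H := by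
    have e : a = (Affine.Point.some _ _ nonsingular_J5_fifty + a) +
        (Affine.Point.some _ _ nonsingular_J5_zero_zero + a) -
        (Affine.Point.some _ _ nonsingular_J5_fiftysix_zero + a) := by
      rw [← fifty_add_zeroZero_J5]; abel
    rw [e]
    exact H.sub_mem (H.add_mem (key _ hg) (key _ hT)) (key _ hgT)
  rcases ha 0 with ⟨-, h'⟩ | ⟨-, h'⟩
  · exact h' H.zero_mem
  · exact h' (by rwa [zero_add])

/-- `(1, 0, −1, 0) • (E₋₅ ⊗ ℚ₂) = J₅ ⊗ ℚ₂`. [folklore] -/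
theorem smul_E5_padic_two :
    (⟨1, 0, -1, 0⟩ : VariableChange ℚ_[2]) • ((⟨0, -105, 0, 2800, 0⟩ : WeierstrassCurve ℚ).baseChange ℚ_[2]) =
      (⟨-2, -106, 0, 2800, 0⟩ : WeierstrassCurve ℤ_[2]).baseChange ℚ_[2] := by
  ext <;> simp only [baseChange, map_a₁, map_a₂, map_a₃, map_a₄, map_a₆, variableChange_a₁,
    variableChange_a₂, variableChange_a₃, variableChange_a₄, variableChange_a₆, map_neg, map_ofNat, map_zero,
    inv_one, Units.val_one] <;> norm_num

/-- `J₅ ⊗ ℚ₂` is a MINIMAL equation over `ℤ₂`. [cite: Kraus1989, Prop. 2] -/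
theorem isMinimal_J5_padic_two :
    ((⟨-2, -106, 0, 2800, 0⟩ : WeierstrassCurve ℤ_[2]).baseChange ℚ_[2]).IsMinimal ℤ_[2] := by
  set w₂ : HeightOneSpectrum (𝓞 ℚ) := (primesEquiv (R := 𝓞 ℚ)).symm ⟨2, Nat.prime_two⟩ with hw₂
  have h2 : ((primesEquiv w₂ : Nat.Primes) : ℕ) = 2 := by rw [hw₂, Equiv.apply_symm_apply]
  have hgen : natGenerator w₂ = 2 := by
    rw [hw₂]; exact Literature.NumberTheory.GaloisRepresentations.Rat.natGenerator_primesEquiv_symm ⟨2, _⟩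
  have hmin₀ := isMinimalAt_twoTorsionModel_neg_five_two w₂ hgen
  have hmin := isMinimalAt_translate (v := w₂) (⟨1, 0, -1, 0⟩ : VariableChange ℤ) rfl model_E5_two hmin₀
  have hmin2 := (isMinimalAt_iff_isMinimal_padic w₂ 2 h2 _).mp hmin
  have e : ((⟨-2, -106, 0, 2800, 0⟩ : WeierstrassCurve ℤ).baseChange ℚ).baseChange ℚ_[2] =
      (⟨-2, -106, 0, 2800, 0⟩ : WeierstrassCurve ℤ_[2]).baseChange ℚ_[2] := by
    ext <;> simp only [baseChange, map_a₁, map_a₂, map_a₃, map_a₄, map_a₆, map_neg, map_ofNat, map_zero]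
  rw [← e]
  exact hmin2

/-- **`c₂(E₋₅) = 4`** (Mathlib's `2`-adics). [cite: Silverman1994, IV.9.4 Step 7 and Table 4.1] -/
theorem localTamagawaNumber_padic_E5_two :
    (haveI := isElliptic_twoTorsionModel_neg_five
     ((⟨0, -105, 0, 2800, 0⟩ : WeierstrassCurve ℚ).baseChange ℚ_[2]).localTamagawaNumber ℤ_[2]) = 4 := by
  haveI := isElliptic_twoTorsionModel_neg_five
  haveI := isMinimal_J5_padic_two
  rw [LocalIndex.localTamagawaNumber_eq_index_of_smul_eq_baseChange _ _ _ smul_E5_padic_two]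
  exact index_nonsingularReductionSubgroup_J5

/-! ## §3 `c₂(X₀(49)^{(−20)}) = 4` -/

/-- `E₋₅ = C • X₀(49)^{(−20)}` over `ℚ` (`X₀(49)^{(−20)} = ⟨½,0,0,0⟩ • X₀(49)^{(−5)}`). [cite: SilvermanAEC2009, X.5 Cor. 5.4] -/
theorem smul_cm7_quadraticTwist_neg_twenty_eq_E5 :
    ((⟨(Units.mk0 (2 : ℚ) two_ne_zero)⁻¹, -10, 0, 0⟩ : VariableChange ℚ) *
        (⟨(Units.mk0 (2 : ℚ) two_ne_zero)⁻¹, 0, 0, 0⟩ : VariableChange ℚ)⁻¹) • cm7.quadraticTwist (-20) =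
      (⟨0, -105, 0, 2800, 0⟩ : WeierstrassCurve ℚ) := by
  have h := quadraticTwist_cm7_four_mul (-5)
  rw [show ((4 * (-5 : ℤ) : ℤ) : ℚ) = -20 by norm_num, show ((-5 : ℤ) : ℚ) = -5 by norm_num] at h
  rw [mul_smul, h, inv_smul_smul]
  exact twoTorsionChange_smul_cm7_quadraticTwist_neg_five

/-- **`c₂(X₀(49)^{(−20)}) = 4`** (Mathlib's `2`-adics). [cite: Silverman1994, IV.9.4 Step 7 and Table 4.1] -/
theorem localTamagawaNumber_padic_cm7_quadraticTwist_neg_twenty :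
    (haveI := cm7.isElliptic_quadraticTwist (show (-20 : ℚ) ≠ 0 by norm_num)
     ((cm7.quadraticTwist (-20)).baseChange ℚ_[2]).localTamagawaNumber ℤ_[2]) = 4 := by
  haveI := cm7.isElliptic_quadraticTwist (show (-20 : ℚ) ≠ 0 by norm_num)
  haveI := isElliptic_twoTorsionModel_neg_five
  set C := ((⟨(Units.mk0 (2 : ℚ) two_ne_zero)⁻¹, -10, 0, 0⟩ : VariableChange ℚ) *
    (⟨(Units.mk0 (2 : ℚ) two_ne_zero)⁻¹, 0, 0, 0⟩ : VariableChange ℚ)⁻¹) with hC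
  have e : (⟨0, -105, 0, 2800, 0⟩ : WeierstrassCurve ℚ).baseChange ℚ_[2] =
      (C.map (algebraMap ℚ ℚ_[2])) • (cm7.quadraticTwist (-20)).baseChange ℚ_[2] := by
    rw [← VariableChange.baseChange_smul_eq, smul_cm7_quadraticTwist_neg_twenty_eq_E5]
  have h := localTamagawaNumber_padic_E5_two
  rw [e, WeierstrassCurve.localTamagawaNumber_variableChange_holds ℤ_[2] ((cm7.quadraticTwist (-20)).baseChange ℚ_[2])] at h
  exact h

end Summit.BirchSwinnertonDyer.BirchSwinnertonDyer.Theorems.GoldfeldGoodTwists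

end
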